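import Summits.RiemannHypothesis.RiemannHypothesis.Theorems.WeilTwoPrimeDeflE72Kappa
import Literature.NumberTheory.LFunctions.WeilTwoPrimeCellsT120CheckAll
import Literature.NumberTheory.LFunctions.WeilTwoPrimeCertificateDeflatedOKEven
import Literature.NumberTheory.LFunctions.WeilBlockRowsR
import HarnessLib

/-!
# Deflated two-prime certificate E72: assembly of the checks and the certified complement level at window `18/25`

`weilCertDeflE72` has a valid chain (`CellsOK₂₃`), passes the moment check and the scalar side conditions, and its EVEN block of `P_r + Σ μ ĉ ĉᵀ` pass `WeilCert.checkBlockP` at `κ' = κ − β₂₃` (`D C = I` rows and `Dn/Ls` rows, Bessel rows, dominance rows from the materialized blocks, `WeilCert.checkDomRowG_of_PZ`, `WeilCert.checkBlockP_of_rows`); the soundness theorem `WeilCert23.weilTwoPrimeQuadratic_rankOne_bound_even_of_cellsOK` [cite: Yoshida1992, §6, Thm 1 p. 310] then certifies **`17/25 · ‖g‖₂² ≤ E₂₃(g) + Σ_i μ_i |Σ_k ĉ_{ik} M_k(g)|²` for every even test function `g` supported in `[-18/25, 18/25]`** (`deflBound_weilCertDeflE72`). Pure proof file.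
-/

noncomputable section

namespace Summit.RiemannHypothesis.RiemannHypothesis.Theorems.EvenWinsBeyondArch

open Literature.NumberTheory.LFunctions
/-- **The chain of certificate E72 is valid** (`CellsOK₂₃` of the chain on `[0, 120]`). [folklore] -/
theorem cellsOK_weilCertDeflE72 : CellsOK₂₃ weilCertDeflE72.base.wL weilCertDeflE72.base.T weilCertDeflE72.cells :=
  cellsOK_weilTwoPrimeCellsT120

end Summit.RiemannHypothesis.RiemannHypothesis.Theorems.EvenWinsBeyondArch
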